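import Summits.BirchSwinnertonDyer.Rank1Residual.Additive.TameBranchUpperOfRatDvd
import Literature.NumberTheory.EllipticCurves.Rank1Residual.X9TrivialPartner
import HarnessLib

/-!
# T3-LIT: a literally non-anomalous rank-`0` (G)-ordinary partner with trivial `p`-arithmetic has
# `char_Λ X(E₁/ℚ_∞) = Λ`, hence `μ(X(E₁/ℚ_∞)) = 0` — an S-sized instantiation of the STANDING
# named fact `Delbourgo2002.mainTheorem` (cell `b2b-bsdres`, team n1011, seat p02 gen 6 — row T3-LIT,
# lead R5-73 (d); spec r2 ROUTE-2 §II.28.3 (b); sketch `cells/n1011/route2/g22/T3lit_sketch.lean`)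

HONEST FRAMING (cell `b2b-bsdres`, run/shared/lean/b2b/bsd-rank1-residual/, verbatim in every
file): the goal of the cell is to DELETE the COMBINATION-SHAPED residual classes of the
Birch–Swinnerton-Dyer formula for ALL analytic-rank `≤ 1` elliptic curves over `ℚ` — "full BSD
formula for every rank `≤ 1` curve in class `C`" assembled STRICTLY from published theorems — so
that the rank-`≤ 1` remainder becomes exactly the CONSTRUCTION-SHAPED classes, which are TYPED
(missing-input `Prop`s), NOT attempted. This is not "finishing BSD". Team n1011 (N10 / N11):
research route; no claim beyond the stated classes; labels UNCHANGED; nothing is booked. Theorems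
only (no definition, no named fact; the named fact `Delbourgo2002.mainTheorem` enters as the
HYPOTHESIS `hDelA` — it is already a binder of T1's printed-input END
`ClassX4Gord.bsdp_rankZero_of_thmC_of_hasUnitContent_of_integral_of_shaAn_unit`, so this file adds no
named-fact debt).

## What this file proves

For a globally minimal `E₁/ℚ` without CM, `p ≥ 5`, `ClassX4Gord W₁ p` (additive, potentially good
ORDINARY at `p` in Delbourgo's global form (G), `E₁[p]` irreducible), `r_an(E₁) = 0`, `p ∤ ∏ c_ℓ(E₁)`,
`L(E₁,1)/Ω_{E₁}` a non-zero rational `p`-adic unit, `BSD(E₁,p)` (Miller's shape `BSDp`), and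
`Delbourgo2002.ReductionNonAnomalous W₁ p` read LITERALLY (census column NA5_lit):

* **`partner_isTorsion_and_charIdeal_eq_top_of_mainTheorem_of_rankZero`** — for the cyclotomic
  `ℤ_p`-extension with `γ` matching the cyclotomic variable and EVERY Pontryagin-dual datum `D₁` of
  `Sel_{p^∞}(E₁/ℚ_∞)`: `X` is `Λ`-torsion (Delbourgo 2002 (A)) and **`char_Λ X = Λ`**.  Proof =
  r2 §II.28.3 (b) by tree name: (A) gives torsion; (B) gives a height datum `Dh` with
  `LeadingTermClauses`; in rank `0` (`BSDp.1` + `r_an = 0`) clause 3 reads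
  `fE(0)·#E₁(ℚ)_tors² = u·ℓ·#Ш[p^∞]·∏c` with `ℓ = 1` (literal non-anomaly), `#Ш[p^∞] = 1`
  (`natCard_selmerGroupPInfty_eq_one_of_bsdp` + Greenberg's `Sel = Ш` in rank `0`), `p ∤ #tors`
  (irreducible), `p ∤ ∏c` — so `fE(0)` is a `p`-adic unit, `fE` is a unit of `Λ = ℤ_p⟦T⟧`, and
  `(fE) = Λ`.  (The situation "the main conjecture is trivially true for `E₁`" of Greenberg–Vatsal
  2000 §1, at an ADDITIVE potentially good ordinary prime; compare `X9TrivialPartner` at a good one.)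
* `partner_mu_eq_zero_of_mainTheorem_of_rankZero` — hence **`D₁.mu = 0`** (the binder of p07's
  T2/K4 composition, `MuLambdaTransferRamifiedOrdinary`), via
  `muInvariant_eq_zero_iff_exists_isUnit_coeff_of_charIdeal_eq_span` with generator `1`.
* `partner_isUnit_of_charIdeal_eq_span` — and every generator `g` of `char_Λ X` is a unit with
  `HasUnitContent g`.

Customer rows (EVIDENCE, r2 §II.28.3 (b), census NA5_lit computed by r2 `route2/g22/`): the
partners of 131100f1, 133350bm1, 233450cr1, 423150da1, 46200dg1 at `p = 5`; NOT 499800el1 (partner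
9800bn1 literal-ANOMALOUS — T3-ctl territory).  This file closes no class and books nothing: it turns
one binder (`D₁.mu = 0`) of a CONDITIONAL END into the census columns of the partner plus `hDelA`.

References: [Delbourgo2002] Thm (A), (B) p. 40, p. 39 (ℓ_p), pp. 69–70; [GreenbergLNM1716] Thm 4.1
(p. 102), §4 p. 103; [GreenbergVatsal2000] §1; [Miller2011LMS] Def. 1.1.
-/

noncomputable section

open scoped Classical

open WeierstrassCurve Literature.NumberTheory.EllipticCurves
  Literature.NumberTheory.EllipticCurves.Rank1Residual
  Literature.NumberTheory.EllipticCurves.GreenbergVatsal2000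

namespace Summit.BirchSwinnertonDyer.Rank1Residual.Additive

variable {p : ℕ} [hp : Fact p.Prime]
variable {W₁ : WeierstrassCurve ℚ} [W₁.IsElliptic] [W₁.IsGloballyMinimal]

/-- **T3-LIT: `char_Λ X(E₁/ℚ_∞) = Λ` on a literally non-anomalous rank-`0` (G)-ordinary partner with
trivial `p`-arithmetic** (Delbourgo 2002 (A)+(B) instantiated at `r = 0`; see the module docstring for
the chain). [cite: Delbourgo2002, Theorem (A), (B) (p. 40), case r_E = 0, ℓ_p(E) = 1 (p. 39)]
[cite: GreenbergLNM1716, Thm. 4.1 (p. 102) and §4 p. 103] -/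
theorem partner_isTorsion_and_charIdeal_eq_top_of_mainTheorem_of_rankZero
    (hDelA : Delbourgo2002.mainTheorem)
    (hGZK : rank_eq_analyticRank_of_analyticRank_le_one)
    (hp5 : 5 ≤ p) (hcm : ¬ W₁.HasCM) (hX₁ : ClassX4Gord W₁ p)
    (hr : W₁.analyticRank = 0) (htam : ¬ p ∣ W₁.tamagawaProduct)
    (hL : ∃ q : ℚ, q ≠ 0 ∧ W₁.entireLFunction 1 / (W₁.realPeriodRat : ℂ) = (q : ℂ) ∧
      padicValRat p q = 0)
    (hbsd : BSDp W₁ p) (hna : Delbourgo2002.ReductionNonAnomalous W₁ p)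
    {κ : ZpExtension ℚ p} {γ : Field.absoluteGaloisGroup ℚ}
    (hκ : κ.IsCyclotomic) (hγ : κ.IsTopGenerator γ) (hcv : IsCyclotomicVariable p γ)
    (D₁ : W₁.SelmerDualData κ γ) : D₁.IsTorsion ∧ D₁.charIdeal = ⊤ := by
  have hpP : p.Prime := hp.out
  haveI : Module.Finite (IwasawaAlgebra p) D₁.X := D₁.module_finite_holds hγ
  have hirr : W₁.HasIrreducibleModPGaloisRep p := hX₁.1.2.2
  -- (A): torsion; (B): a height datum with the leading-term clauses
  have hX : D₁.IsTorsion :=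
    Delbourgo2002.mainTheorem.isTorsion hDelA hp5 hcm hX₁.1.2.1 hX₁.2 hκ hγ D₁
  obtain ⟨Dh, hB⟩ :=
    Delbourgo2002.mainTheorem.exists_leadingTermClauses hDelA hp5 hcm hX₁.1.2.1 hX₁.2
  refine ⟨hX, ?_⟩
  -- a generator of the (principal) characteristic ideal
  obtain ⟨fE, hfE⟩ := (charIdeal_isPrincipal_holds p D₁.X).principal
  have hchar : D₁.charIdeal = Ideal.span {fE} := hfE
  -- rank 0: `E₁(ℚ)` finite; `#Sel_{p^∞} = 1 = #Ш[p^∞]`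
  have hr0 : W₁.mordellWeilRank = 0 := hbsd.1.trans hr
  haveI : Finite W₁.toAffine.Point := W₁.mordellWeilRank_eq_zero_iff_finite.mp hr0
  have hSel := natCard_selmerGroupPInfty_eq_one_of_bsdp hGZK W₁ p hirr hr htam hL hbsd
  have hSha : Nat.card (AddCommGroup.primaryComponent W₁.sha p) = 1 := by
    rw [← W₁.natCard_selmerGroupPInfty_eq_natCard_primaryComponent_sha p]; exact hSel
  have hfin : Finite (AddCommGroup.primaryComponent W₁.sha p) :=
    Nat.finite_of_card_ne_zero (by rw [hSha]; exact one_ne_zero)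
  -- clause 3 at `r = 0`: `fE(0)·#tors² = u·ℓ·(#Ш[p^∞]·∏c)`, `ℓ = 1`, `#Ш[p^∞] = 1`
  obtain ⟨-, u, ℓ, -, hℓ, heq⟩ := hB.constantCoeff hκ hγ hcv D₁ hX hchar hfin
  rw [hℓ hna, hSha, Nat.cast_one, mul_one, one_mul] at heq
  -- `heq : fE(0) · #tors² = u · ∏c`
  have hT : 0 < W₁.torsionOrder := W₁.torsionOrder_pos_holds
  have hc : 0 < W₁.tamagawaProduct := W₁.tamagawaProduct_pos'
  have hT0 : (W₁.torsionOrder : ℚ_[p]) ≠ 0 := by exact_mod_cast hT.ne'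
  have hc0 : (W₁.tamagawaProduct : ℚ_[p]) ≠ 0 := by exact_mod_cast hc.ne'
  have hf0 : ((PowerSeries.constantCoeff fE : ℤ_[p]) : ℚ_[p]) ≠ 0 := by
    intro h0
    rw [h0, zero_mul] at heq
    exact mul_ne_zero (coe_units_ne_zero p u) hc0 heq.symm
  have hvT : (W₁.torsionOrder : ℚ_[p]).valuation = 0 := by
    rw [Padic.valuation_natCast, padicValNat_torsionOrder_eq_zero_of_irreducible W₁ p hirr]
    rfl
  have hvc : (W₁.tamagawaProduct : ℚ_[p]).valuation = 0 := by
    rw [Padic.valuation_natCast, padicValNat.eq_zero_of_not_dvd htam]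
    rfl
  have hvf : ((PowerSeries.constantCoeff fE : ℤ_[p]) : ℚ_[p]).valuation = 0 := by
    have h := congrArg Padic.valuation heq
    rw [Padic.valuation_mul hf0 (pow_ne_zero 2 hT0), Padic.valuation_pow, hvT, mul_zero, add_zero,
      Padic.valuation_mul (coe_units_ne_zero p u) hc0, valuation_coe_units_eq_zero, hvc, add_zero] at h
    exact h
  have hfunit : IsUnit fE :=
    PowerSeries.isUnit_iff_constantCoeff.mpr (isUnit_of_valuation_coe_eq_zero _ hf0 hvf)
  rw [hchar, Ideal.span_singleton_eq_top]
  exact hfunit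

/-- **Hence `μ(X(E₁/ℚ_∞)) = 0`** for every cyclotomic dual datum of the partner (`char X = Λ = (1)`,
and the coefficient `1` of the generator `1` is a unit) — the `D₁.mu = 0` binder of p07's T2/K4
composition (`MuLambdaTransferRamifiedOrdinary`). [cite: Delbourgo2002, Theorem (A), (B) (p. 40)]
[cite: GreenbergVatsal2000, p. 2, (1)–(2)] -/
theorem partner_mu_eq_zero_of_mainTheorem_of_rankZero
    (hDelA : Delbourgo2002.mainTheorem)
    (hGZK : rank_eq_analyticRank_of_analyticRank_le_one)
    (hp5 : 5 ≤ p) (hcm : ¬ W₁.HasCM) (hX₁ : ClassX4Gord W₁ p)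
    (hr : W₁.analyticRank = 0) (htam : ¬ p ∣ W₁.tamagawaProduct)
    (hL : ∃ q : ℚ, q ≠ 0 ∧ W₁.entireLFunction 1 / (W₁.realPeriodRat : ℂ) = (q : ℂ) ∧
      padicValRat p q = 0)
    (hbsd : BSDp W₁ p) (hna : Delbourgo2002.ReductionNonAnomalous W₁ p)
    {κ : ZpExtension ℚ p} {γ : Field.absoluteGaloisGroup ℚ}
    (hκ : κ.IsCyclotomic) (hγ : κ.IsTopGenerator γ) (hcv : IsCyclotomicVariable p γ)
    (D₁ : W₁.SelmerDualData κ γ) : D₁.IsTorsion ∧ D₁.mu = 0 := by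
  haveI : Module.Finite (IwasawaAlgebra p) D₁.X := D₁.module_finite_holds hγ
  obtain ⟨hX, htop⟩ := partner_isTorsion_and_charIdeal_eq_top_of_mainTheorem_of_rankZero hDelA hGZK
    hp5 hcm hX₁ hr htam hL hbsd hna hκ hγ hcv D₁
  refine ⟨hX, ?_⟩
  have h1 : D₁.charIdeal = Ideal.span {(1 : IwasawaAlgebra p)} := by
    rw [htop, Ideal.span_singleton_one]
  have := (muInvariant_eq_zero_iff_exists_isUnit_coeff_of_charIdeal_eq_span (p := p) D₁.X hX h1).mpr
    ⟨0, by rw [PowerSeries.coeff_zero_eq_constantCoeff, map_one]; exact isUnit_one⟩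
  exact this

/-- **Every generator of `char_Λ X(E₁/ℚ_∞)` is a unit of `Λ` with unit content** (`HasUnitContent`,
the currency of T1's `hμ` binder). [cite: Delbourgo2002, Theorem (A), (B) (p. 40)]
[cite: GreenbergVatsal2000, p. 2, (1)–(2)] -/
theorem partner_isUnit_of_charIdeal_eq_span
    (hDelA : Delbourgo2002.mainTheorem)
    (hGZK : rank_eq_analyticRank_of_analyticRank_le_one)
    (hp5 : 5 ≤ p) (hcm : ¬ W₁.HasCM) (hX₁ : ClassX4Gord W₁ p)
    (hr : W₁.analyticRank = 0) (htam : ¬ p ∣ W₁.tamagawaProduct)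
    (hL : ∃ q : ℚ, q ≠ 0 ∧ W₁.entireLFunction 1 / (W₁.realPeriodRat : ℂ) = (q : ℂ) ∧
      padicValRat p q = 0)
    (hbsd : BSDp W₁ p) (hna : Delbourgo2002.ReductionNonAnomalous W₁ p)
    {κ : ZpExtension ℚ p} {γ : Field.absoluteGaloisGroup ℚ}
    (hκ : κ.IsCyclotomic) (hγ : κ.IsTopGenerator γ) (hcv : IsCyclotomicVariable p γ)
    (D₁ : W₁.SelmerDualData κ γ) {g : IwasawaAlgebra p} (hg : D₁.charIdeal = Ideal.span {g}) :
    IsUnit g ∧ HasUnitContent g := by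
  obtain ⟨hX, htop⟩ := partner_isTorsion_and_charIdeal_eq_top_of_mainTheorem_of_rankZero hDelA hGZK
    hp5 hcm hX₁ hr htam hL hbsd hna hκ hγ hcv D₁
  have hunit : IsUnit g := by rw [← Ideal.span_singleton_eq_top, ← hg]; exact htop
  refine ⟨hunit, ?_⟩
  obtain ⟨-, hμ⟩ := partner_mu_eq_zero_of_mainTheorem_of_rankZero hDelA hGZK hp5 hcm hX₁ hr htam hL
    hbsd hna hκ hγ hcv D₁
  exact hasUnitContent_of_charIdeal_eq_span_of_mu_zero hγ D₁ hX hμ hg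

end Summit.BirchSwinnertonDyer.Rank1Residual.Additive

namespace Summit.BirchSwinnertonDyer.Rank1Residual.Additive

variable {p : ℕ} [hp : Fact p.Prime]
variable {W₁ : WeierstrassCurve ℚ} [W₁.IsElliptic] [W₁.IsGloballyMinimal]

/-- **COROLLARY 3 (r2 ROUTE-2 §II.28.3 (b) verbatim shape): `μ(X(E₁/ℚ_∞)) = 0 ∧ λ(X(E₁/ℚ_∞)) = 0`**
for every cyclotomic dual datum of a literally non-anomalous rank-`0` (G)-ordinary partner with trivial
`p`-arithmetic: `char X = Λ = (1)` and the `λ`-invariant of a module with unit characteristic power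
series vanishes (`ParitySqueeze.lam_generator_eq_lambdaInvariant` at the generator `1`,
`lam_eq_zero_of_isUnit`). [cite: Delbourgo2002, Theorem (A), (B) (p. 40)]
[cite: GreenbergVatsal2000, p. 2, (1)–(2)] [cite: Washington1997, §13.2 and Prop. 13.8] -/
theorem partner_mu_eq_zero_and_lambda_eq_zero_of_mainTheorem_of_rankZero
    (hDelA : Delbourgo2002.mainTheorem)
    (hGZK : rank_eq_analyticRank_of_analyticRank_le_one)
    (hp5 : 5 ≤ p) (hcm : ¬ W₁.HasCM) (hX₁ : ClassX4Gord W₁ p)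
    (hr : W₁.analyticRank = 0) (htam : ¬ p ∣ W₁.tamagawaProduct)
    (hL : ∃ q : ℚ, q ≠ 0 ∧ W₁.entireLFunction 1 / (W₁.realPeriodRat : ℂ) = (q : ℂ) ∧
      padicValRat p q = 0)
    (hbsd : BSDp W₁ p) (hna : Delbourgo2002.ReductionNonAnomalous W₁ p)
    {κ : ZpExtension ℚ p} {γ : Field.absoluteGaloisGroup ℚ}
    (hκ : κ.IsCyclotomic) (hγ : κ.IsTopGenerator γ) (hcv : IsCyclotomicVariable p γ)
    (D₁ : W₁.SelmerDualData κ γ) : D₁.IsTorsion ∧ D₁.mu = 0 ∧ D₁.lambda = 0 := by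
  haveI : Module.Finite (IwasawaAlgebra p) D₁.X := D₁.module_finite_holds hγ
  obtain ⟨hX, hμ⟩ := partner_mu_eq_zero_of_mainTheorem_of_rankZero hDelA hGZK hp5 hcm hX₁ hr htam hL
    hbsd hna hκ hγ hcv D₁
  obtain ⟨-, htop⟩ := partner_isTorsion_and_charIdeal_eq_top_of_mainTheorem_of_rankZero hDelA hGZK
    hp5 hcm hX₁ hr htam hL hbsd hna hκ hγ hcv D₁
  refine ⟨hX, hμ, ?_⟩
  have h1 : Literature.NumberTheory.EllipticCurves.Module.charIdeal (IwasawaAlgebra p) D₁.X =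
      Ideal.span {(1 : IwasawaAlgebra p)} := by
    rw [Ideal.span_singleton_one]; exact htop
  have hlam := X1.ParitySqueeze.lam_generator_eq_lambdaInvariant (p := p) D₁.X hX one_ne_zero h1
  rw [X1.ParitySqueeze.lam_eq_zero_of_isUnit isUnit_one] at hlam
  exact hlam.symm

end Summit.BirchSwinnertonDyer.Rank1Residual.Additive
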